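import Literature.NumberTheory.EllipticCurves.ShaRestriction
import Literature.NumberTheory.EllipticCurves.BSDSelmerParityDokchitserBaseChangeProofs
import Literature.NumberTheory.EllipticCurves.ShaPTorsionQuadraticSplitting
import Literature.NumberTheory.EllipticCurves.LeadingTermProofs
import Literature.NumberTheory.EllipticCurves.SelmerCorankHolds
import Literature.NumberTheory.EllipticCurves.IwasawaLeadingTermProofs
import Literature.NumberTheory.EllipticCurves.ZpCorankQuasiIso
import Literature.NumberTheory.EllipticCurves.ShaFiniteProofs
import Literature.Algebra.Module.AlternatingPairingParity
import HarnessLib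

/-!
# The corank `t_p = corank_{ℤ_p} Ш[p^∞]` under base change: monotone along every finite extension, additive over a
# quadratic field (`t_p(E_K) = t_p(E) + t_p(E^{(c)})`, every prime `p`)

Topic `NumberTheory/EllipticCurves`; theorems only (no definition, no named fact, no `sorry`, no instance). ROUTE-INDEPENDENT
home (no `Summits` import) of the base-change bookkeeping for `WeierstrassCurve.shaCorank` first written inside the summit
file `Summits/…/ShaPrimaryTransferFiniteShaComponentTransferBaseChange` (which imports a route file; the gate's
`theses-cone` lint asks for a route-free module), plus the `c`-currency form of the quadratic identity:

* `Literature.NumberTheory.EllipticCurves.zpCorank_le_of_finite_ker` — the corank formula does not drop along a homomorphism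
  with finite kernel between `p`-primary groups with finite `p`-torsion (Greenberg 1999 §1);
* `WeierstrassCurve.shaCorank_le_baseChange` — `t_p(E/K) ≤ t_p(E_L/L)` for every finite extension `L/K` of number fields
  (the restriction `Ш(E/K) → Ш(E_L/L)` has finite kernel, Darmon 2004 Exercise 3.18, tree `finite_ker_shaRestriction`);
  `shaCorank_eq_zero_of_shaCorank_baseChange_eq_zero`, `finite_primaryComponent_sha_of_baseChange`;
* `WeierstrassCurve.shaCorank_baseChange_eq_add` — for `K = ℚ(θ)`, `θ² = c` and EVERY prime `p` (`p = 2` included):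
  `t_p(E_K) = t_p(E) + t_p(E^{(c)})` (three discharged tree facts: `selmerCorank_baseChange_eq_add` — T. Dokchitser 2013 §4 /
  Dokchitser–Dokchitser 2010 Lemma 4.14 —, `mordellWeilRank_baseChange_eq_add` — Silverman X Exercise 10.16 —, and
  `selmerCorank_eq_mordellWeilRank_add_holds` — Greenberg 1999 §1); discriminant form `shaCorank_baseChange_quadratic_discr`;
  `Ш(E_K)[p^∞]` finite iff both `Ш(E)[p^∞]`, `Ш(E^{(c)})[p^∞]` are.

## References

* H. Darmon, *Rational points on modular elliptic curves*, CBMS 101 (2004), §3.9, Exercise 3.18. [Darmon2004]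
* T. Dokchitser, Notes on the parity conjecture (2013), §4. [Dokchitser2013ParityNotes]
* T. Dokchitser, V. Dokchitser, On the BSD quotients modulo squares, Ann. of Math. 172 (2010), Lemma 4.14.
  [DokchitserDokchitserAnnals2010]
* R. Greenberg, Iwasawa theory for elliptic curves, LNM 1716 (1999), §1. [Greenberg1999LNM]
* J. H. Silverman, *The Arithmetic of Elliptic Curves*, 2nd ed. (2009), X.4, Exercise 10.16. [SilvermanAEC2009]
-/

noncomputable section

open scoped Classical AddSubgroup

universe u

namespace Literature.NumberTheory.EllipticCurves

/-- **Monotonicity of the corank formula along a finite-kernel map** (Greenberg 1999 §1): for `p`-primary abelian groups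
`A`, `B` with finite `p`-torsion and `F : A → B` with finite kernel, `zpCorank A p ≤ zpCorank B p`.
[cite: Greenberg1999LNM, §1 pp. 54–57] -/
theorem zpCorank_le_of_finite_ker {A B : Type*} [AddCommGroup A] [AddCommGroup B] {p : ℕ} [Fact p.Prime]
    (F : A →+ B) (hA : ∀ a : A, ∃ n : ℕ, p ^ n • a = 0) (hB : ∀ b : B, ∃ n : ℕ, p ^ n • b = 0)
    [Finite A[(p : ℤ)]] [Finite B[(p : ℤ)]] [Finite F.ker] : zpCorank A p ≤ zpCorank B p := by
  have h1 : zpCorank A p = zpCorank F.range p :=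
    zpCorank_eq_of_shortExact_of_finite_left (i := F.ker.subtype) (f := F.rangeRestrict)
      Subtype.val_injective F.rangeRestrict_surjective
      (fun a ha ↦ ⟨⟨a, by simpa using congrArg (fun z : F.range ↦ (z : B)) ha⟩, rfl⟩)
      (fun a ↦ Subtype.ext a.2) hA
  have h2 : zpCorank B p = zpCorank F.range p + zpCorank (B ⧸ F.range) p :=
    zpCorank_eq_add_of_shortExact (i := F.range.subtype) (f := QuotientAddGroup.mk' F.range)
      Subtype.val_injective (QuotientAddGroup.mk'_surjective _)
      (fun b hb ↦ ⟨⟨b, (QuotientAddGroup.eq_zero_iff b).mp hb⟩, rfl⟩)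
      (fun a ↦ (QuotientAddGroup.eq_zero_iff _).mpr a.2) hB
  omega

end Literature.NumberTheory.EllipticCurves

namespace WeierstrassCurve

open Literature.NumberTheory.EllipticCurves Literature.NumberTheory.QuadraticFields Literature.Algebra.Module

/-! ## Any finite extension `L/K`: `t_p(E/K) ≤ t_p(E_L/L)` -/

section AnyExtension

variable {K : Type} [Field K] [NumberField K] (W : WeierstrassCurve K) [W.IsElliptic]
  (L : Type) [Field L] [NumberField L] [Algebra K L] (p : ℕ) [hp : Fact p.Prime]

/-- **`t_p(E/K) ≤ t_p(E_L/L)`**: the corank of `Ш[p^∞]` does not drop under a finite base change (restriction has finite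
kernel, Darmon 2004 Exercise 3.18; coranks are monotone along finite-kernel maps, Greenberg 1999 §1). Deliberate dot-notation
extension of Mathlib's `WeierstrassCurve` namespace. [cite: Darmon2004, §3.9 and Exercise 3.18] [cite: Greenberg1999LNM, §1 pp. 54–57] -/
theorem shaCorank_le_baseChange : W.shaCorank p ≤ (W.baseChange L).shaCorank p := by
  haveI : (W.baseChange L).IsElliptic := by rw [WeierstrassCurve.baseChange]; infer_instance
  have hp0 : ((p : ℕ) : ℤ) ≠ 0 := by exact_mod_cast hp.out.ne_zero
  set f : W.sha →+ (W.baseChange L).sha := shaRestriction W L with hf_def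
  set A : AddSubgroup W.sha := AddCommGroup.primaryComponent W.sha p with hA_def
  set B : AddSubgroup (W.baseChange L).sha := AddCommGroup.primaryComponent (W.baseChange L).sha p with hB_def
  have hfmem : ∀ a : A, f a ∈ B := fun a ↦ by
    obtain ⟨k, hk⟩ := (AddCommGroup.mem_primaryComponent).mp a.2
    exact (AddCommGroup.mem_primaryComponent).mpr ⟨k, by rw [← map_nsmul, hk, map_zero]⟩
  let F : A →+ B := (f.comp A.subtype).codRestrict B fun a ↦ hfmem a
  have hF : ∀ a : A, ((F a : B) : (W.baseChange L).sha) = f a := fun _ ↦ rfl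
  have hAprim : ∀ a : A, ∃ k : ℕ, p ^ k • a = 0 := fun a ↦ by
    obtain ⟨k, hk⟩ := (AddCommGroup.mem_primaryComponent).mp a.2
    exact ⟨k, Subtype.ext (by rw [AddSubgroupClass.coe_nsmul, hk, ZeroMemClass.coe_zero])⟩
  have hBprim : ∀ b : B, ∃ k : ℕ, p ^ k • b = 0 := fun b ↦ by
    obtain ⟨k, hk⟩ := (AddCommGroup.mem_primaryComponent).mp b.2
    exact ⟨k, Subtype.ext (by rw [AddSubgroupClass.coe_nsmul, hk, ZeroMemClass.coe_zero])⟩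
  haveI : Finite ((W.sha)[(p : ℤ)]) := W.finite_sha_torsionBy_holds (p : ℤ) hp0
  haveI : Finite (((W.baseChange L).sha)[(p : ℤ)]) := (W.baseChange L).finite_sha_torsionBy_holds (p : ℤ) hp0
  haveI : Finite (A[(p : ℤ)]) := Nat.finite_of_card_ne_zero (by
    rw [hA_def, natCard_torsionBy_primaryComponent]; exact Nat.card_pos.ne')
  haveI : Finite (B[(p : ℤ)]) := Nat.finite_of_card_ne_zero (by
    rw [hB_def, natCard_torsionBy_primaryComponent]; exact Nat.card_pos.ne')
  haveI : Finite f.ker := (finite_ker_shaRestriction W L).to_subtype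
  haveI : Finite F.ker := by
    refine Finite.of_injective (fun x : F.ker ↦ (⟨((x : A) : W.sha), ?_⟩ : f.ker)) ?_
    · rw [AddMonoidHom.mem_ker, ← hF]
      have hx : F x = 0 := x.2
      rw [hx]; rfl
    · intro x y hxy
      exact Subtype.ext (Subtype.ext (congrArg (fun z : f.ker ↦ (z : W.sha)) hxy))
  have key := zpCorank_le_of_finite_ker F hAprim hBprim
  simpa only [shaCorank] using key

/-- **A closed door upstairs is a closed door downstairs**: `t_p(E_L/L) = 0 ⟹ t_p(E/K) = 0`.
[cite: Darmon2004, §3.9 and Exercise 3.18] -/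
theorem shaCorank_eq_zero_of_shaCorank_baseChange_eq_zero (h0 : (W.baseChange L).shaCorank p = 0) :
    W.shaCorank p = 0 := by
  have h := W.shaCorank_le_baseChange L p
  omega

/-- **`Ш(E_L/L)[p^∞]` finite ⟹ `Ш(E/K)[p^∞]` finite**, prime by prime (the `p`-primary form of the tree's
`shaFinite_of_baseChange`). [cite: Darmon2004, §3.9 and Exercise 3.18] -/
theorem finite_primaryComponent_sha_of_baseChange
    (h : Finite ↥(AddCommGroup.primaryComponent (W.baseChange L).sha p)) :
    Finite ↥(AddCommGroup.primaryComponent W.sha p) := by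
  haveI : (W.baseChange L).IsElliptic := by rw [WeierstrassCurve.baseChange]; infer_instance
  rw [finite_primaryComponent_sha_iff_shaCorank_eq_zero] at h ⊢
  exact W.shaCorank_eq_zero_of_shaCorank_baseChange_eq_zero L p h

end AnyExtension

/-! ## A quadratic field: `t_p(E_K) = t_p(E) + t_p(E^{(c)})`, every prime `p` -/

section Quadratic

variable (W : WeierstrassCurve ℚ) [W.IsElliptic] (K : Type) [Field K] [NumberField K]
  (h2 : Module.finrank ℚ K = 2) {θ : K} {c : ℚ} (hθ : θ ∉ Set.range (algebraMap ℚ K))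
  (hc : θ ^ 2 = algebraMap ℚ K c) (p : ℕ) [hp : Fact p.Prime]

include h2 hθ hc in
/-- **`t_p(E_K) = t_p(E/ℚ) + t_p(E^{(c)}/ℚ)` for `K = ℚ(θ)`, `θ² = c`, and EVERY prime `p`** (`p = 2` included):
`corank Sel_{p^∞}` splits (`selmerCorank_baseChange_eq_add`, T. Dokchitser 2013 §4 / Dokchitser–Dokchitser 2010 Lemma 4.14),
`rank` splits (`mordellWeilRank_baseChange_eq_add`, Silverman X Exercise 10.16), and `corank Sel_{p^∞} = rank + corank Ш[p^∞]`
three times (Greenberg 1999 §1). Deliberate dot-notation extension of Mathlib's `WeierstrassCurve` namespace.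
[cite: Dokchitser2013ParityNotes, §4, proof of the Theorem "[Squarity, NekIV, Kurast]", first display]
[cite: DokchitserDokchitserAnnals2010, Lemma 4.14] [cite: SilvermanAEC2009, Exercise 10.16] -/
theorem shaCorank_baseChange_eq_add :
    (W.baseChange K).shaCorank p = W.shaCorank p + (W.quadraticTwist c).shaCorank p := by
  haveI : (W.baseChange K).IsElliptic := by rw [WeierstrassCurve.baseChange]; infer_instance
  have hc0 : c ≠ 0 := by
    rintro rfl
    apply Quadratic.ne_zero_of_not_mem_range hθ
    have : θ ^ 2 = 0 := by rw [hc, map_zero]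
    exact pow_eq_zero_iff (n := 2) (by norm_num) |>.mp this
  haveI : (W.quadraticTwist c).IsElliptic := W.isElliptic_quadraticTwist hc0
  have hS := selmerCorank_baseChange_eq_add W K h2 hθ hc p
  have hR := W.mordellWeilRank_baseChange_eq_add K h2 hθ hc
  have hK := (W.baseChange K).selmerCorank_eq_mordellWeilRank_add_holds p
  have hQ := W.selmerCorank_eq_mordellWeilRank_add_holds p
  have hT := (W.quadraticTwist c).selmerCorank_eq_mordellWeilRank_add_holds p
  omega

include h2 hθ hc in
/-- **The door over `K` is two doors over `ℚ`** (`c`-currency): `t_p(E_K) = 0 ⟺ t_p(E) = 0 ∧ t_p(E^{(c)}) = 0`.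
[cite: Dokchitser2013ParityNotes, §4] -/
theorem shaCorank_baseChange_eq_zero_iff_of_sq_eq :
    (W.baseChange K).shaCorank p = 0 ↔ W.shaCorank p = 0 ∧ (W.quadraticTwist c).shaCorank p = 0 := by
  have h := W.shaCorank_baseChange_eq_add K h2 hθ hc p
  omega

include h2 hθ hc in
/-- **`Ш(E_K)[p^∞]` finite iff `Ш(E)[p^∞]` and `Ш(E^{(c)})[p^∞]` are** (every prime `p`).
[cite: Dokchitser2013ParityNotes, §4] [cite: Darmon2004, §3.9] -/
theorem finite_primaryComponent_sha_baseChange_iff_of_sq_eq :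
    Finite ↥(AddCommGroup.primaryComponent (W.baseChange K).sha p) ↔
      Finite ↥(AddCommGroup.primaryComponent W.sha p) ∧
        Finite ↥(AddCommGroup.primaryComponent (W.quadraticTwist c).sha p) := by
  haveI : (W.baseChange K).IsElliptic := by rw [WeierstrassCurve.baseChange]; infer_instance
  have hc0 : c ≠ 0 := by
    rintro rfl
    apply Quadratic.ne_zero_of_not_mem_range hθ
    have : θ ^ 2 = 0 := by rw [hc, map_zero]
    exact pow_eq_zero_iff (n := 2) (by norm_num) |>.mp this
  haveI : (W.quadraticTwist c).IsElliptic := W.isElliptic_quadraticTwist hc0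
  rw [finite_primaryComponent_sha_iff_shaCorank_eq_zero, finite_primaryComponent_sha_iff_shaCorank_eq_zero,
    finite_primaryComponent_sha_iff_shaCorank_eq_zero]
  exact W.shaCorank_baseChange_eq_zero_iff_of_sq_eq K h2 hθ hc p

/-- **Discriminant form**: `t_p(E_K) = t_p(E) + t_p(E^{(d_K)})` for every quadratic field `K` and every prime `p`
(`d_K`-currency, from the tree facts `selmerCorank_baseChange_quadratic_holds`, `mordellWeilRank_baseChange_quadratic_holds`).
[cite: Dokchitser2013ParityNotes, §4] [cite: SilvermanAEC2009, Exercise 10.16] -/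
theorem shaCorank_baseChange_quadratic_discr (W : WeierstrassCurve ℚ) [W.IsElliptic] (K : Type) [Field K] [NumberField K]
    (h2 : Module.finrank ℚ K = 2) (p : ℕ) [Fact p.Prime] :
    (W.baseChange K).shaCorank p = W.shaCorank p + (W.quadraticTwist (NumberField.discr K : ℚ)).shaCorank p := by
  haveI : (W.baseChange K).IsElliptic := by rw [WeierstrassCurve.baseChange]; infer_instance
  have hd : ((NumberField.discr K : ℤ) : ℚ) ≠ 0 := by exact_mod_cast NumberField.discr_ne_zero K
  haveI : (W.quadraticTwist (NumberField.discr K : ℚ)).IsElliptic := W.isElliptic_quadraticTwist hd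
  have hS := selmerCorank_baseChange_quadratic_holds W K h2 p
  have hR := mordellWeilRank_baseChange_quadratic_holds W K h2
  have hK := (W.baseChange K).selmerCorank_eq_mordellWeilRank_add_holds p
  have hQ := W.selmerCorank_eq_mordellWeilRank_add_holds p
  have hT := (W.quadraticTwist (NumberField.discr K : ℚ)).selmerCorank_eq_mordellWeilRank_add_holds p
  omega

include h2 hθ hc in
/-- **The two twist currencies agree on coranks**: `t_p(E^{(c)}) = t_p(E^{(d_K)})` for `K = ℚ(θ)`, `θ² = c` (both equal
`t_p(E_K) - t_p(E)`). [cite: Dokchitser2013ParityNotes, §4] -/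
theorem shaCorank_quadraticTwist_eq_discr :
    (W.quadraticTwist c).shaCorank p = (W.quadraticTwist (NumberField.discr K : ℚ)).shaCorank p := by
  have h1 := W.shaCorank_baseChange_eq_add K h2 hθ hc p
  have h2' := W.shaCorank_baseChange_quadratic_discr K h2 p
  omega

end Quadratic

end WeierstrassCurve

end
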